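import Literature.Probability.RandomPlanarGeometry.SLERestrictionAlive
import Literature.Probability.RandomPlanarGeometry.RestrictionOuterHulls
import Literature.Probability.RandomPlanarGeometry.LoewnerBoundaryExtension
import HarnessLib

/-!
# `ω ↦ Φ'_{A_t}(W_t)` is a random variable ([LSW] §5: `Y_t = h_t'(W_t)^{5/8}` is a process)

For a family of continuous driving functions `W ω` from `0` with measurable values at times
`≤ t` (as in `SLERestrictionAlive`: `𝓜 = 𝓕ᵂ_t` gives adaptedness) and a nonempty `*`-hull `A`,
the derivative `d_t(ω) = starDeriv (slidHull (W ω) A t) = Φ'_{A_t - W_t}(0)` of the slid hull,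
restricted to the alive event (set to `0` outside it), is `𝓜`-measurable
(`measurable_indicator_starDeriv_slidHull`).

Proof: on the alive event `B_t(ω)` is a `*`-hull, the points `b_k(ω) = g_t(a_k) - W_t`
(`a_k` dense in `A ∩ ℍ`) are dense in it and are measurable in `ω` (`LoewnerAdaptedPlane`); the
dyadic outer hulls `outerHull n (outerConfig b(ω) n)` of `RestrictionOuterHulls` are functions of
the FINITE configurations `outerConfig b(ω) n`, which are measurable as maps into the countable
set of finite configurations; their derivatives converge to `d_t(ω)`
(`tendsto_starDeriv_outerHull`); and a pointwise limit of measurable functions is measurable.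

## References

* G. F. Lawler, O. Schramm, W. Werner, *Conformal restriction: the chordal case* (2003), §5
  [LawlerSchrammWerner2003Restriction].
-/

noncomputable section

open Set Filter Metric Function MeasureTheory Bornology
open _root_.Complex _root_.Topology
open UpperHalfPlane (upperHalfPlaneSet)
open scoped NNReal

namespace Literature.Probability.RandomPlanarGeometry

namespace Loewner

variable {Ω : Type*} {mΩ : MeasurableSpace Ω} {W : Ω → ℝ≥0 → ℝ} {A : Set ℂ} {t : ℝ≥0} {a : ℕ → ℂ}

/-! ### The points `b_k(ω) = g_t(a_k) - W_t` -/

/-- The slid images of the dense points. [folklore] -/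
def slidPt (W : Ω → ℝ≥0 → ℝ) (a : ℕ → ℂ) (t : ℝ≥0) (k : ℕ) (ω : Ω) : ℂ := map (W ω) t (a k) - W ω t

/-- The slid points are measurable. [folklore] -/
theorem measurable_slidPt (hc : ∀ ω, Continuous (W ω)) (hmeas : ∀ s, s ≤ t → Measurable fun ω ↦ W ω s)
    (ha : ∀ k, 0 < (a k).im) (k : ℕ) : Measurable (slidPt W a t k) :=
  (measurable_map_of_im_pos hc hmeas (ha k)).sub (Complex.measurable_ofReal.comp (hmeas t le_rfl))

/-- The slid points lie in the slid hull. [folklore] -/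
theorem slidPt_mem (ha : ∀ k, a k ∈ A) (k : ℕ) (ω : Ω) : slidPt W a t k ω ∈ slidHull (W ω) A t :=
  mem_slidHull_iff.2 ⟨a k, ha k, rfl⟩

/-- **The slid points are uniformly bounded along each path** (alive points of `ℍ` move by at most
`2M + 13√t`, `norm_map_sub_self_le_of_mem_domain`; swallowed points do not move at all under the
junk convention of `map`). [folklore] -/
theorem isBounded_range_slidPt (hc : ∀ ω, Continuous (W ω)) (hA : IsBounded A) (ha : ∀ k, a k ∈ A ∧ 0 < (a k).im)
    (ω : Ω) : IsBounded (range fun k ↦ slidPt W a t k ω) := by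
  obtain ⟨R, hR⟩ := hA.subset_closedBall 0
  obtain ⟨M, hM⟩ := isCompact_Icc.exists_bound_of_continuousOn (s := Icc (0 : ℝ) t)
    ((Complex.continuous_ofReal.comp ((hc ω).comp continuous_real_toNNReal)).continuousOn)
  have hM' : ∀ u ∈ Icc (0 : ℝ) t, ‖((W ω u.toNNReal : ℝ) : ℂ) - 0‖ ≤ M := fun u hu ↦ by
    rw [sub_zero]; exact hM u hu
  refine (isBounded_closedBall (x := (0 : ℂ)) (r := R + (2 * M + 13 * Real.sqrt t) + ‖((W ω t : ℝ) : ℂ)‖)).subset ?_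
  rintro _ ⟨k, rfl⟩
  rw [mem_closedBall, dist_zero_right]
  show ‖map (W ω) t (a k) - W ω t‖ ≤ _
  have hak : ‖a k‖ ≤ R := by simpa [mem_closedBall, dist_zero_right] using hR (ha k).1
  have hmove : ‖map (W ω) t (a k) - a k‖ ≤ 2 * M + 13 * Real.sqrt t := by
    by_cases halive : (t : WithTop ℝ≥0) < swallowingTime (W ω) (a k)
    · exact norm_map_sub_self_le_of_mem_domain (hc ω) hM' ((mem_domain_iff _ _ _).2 ⟨(ha k).2, halive⟩)
    · rw [map_of_not_lt_swallowingTime halive, sub_self, norm_zero]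
      have := (norm_nonneg _).trans (hM' 0 ⟨le_rfl, t.coe_nonneg⟩)
      positivity
  calc ‖map (W ω) t (a k) - W ω t‖ = ‖(map (W ω) t (a k) - a k) + a k - W ω t‖ := by ring_nf
    _ ≤ ‖(map (W ω) t (a k) - a k) + a k‖ + ‖((W ω t : ℝ) : ℂ)‖ := norm_sub_le _ _
    _ ≤ ‖map (W ω) t (a k) - a k‖ + ‖a k‖ + ‖((W ω t : ℝ) : ℂ)‖ := by gcongr; exact norm_add_le _ _
    _ ≤ R + (2 * M + 13 * Real.sqrt t) + ‖((W ω t : ℝ) : ℂ)‖ := by linarith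

/-- **On the alive event the slid points are dense in the slid hull** (`z ↦ g_t(z) - W_t` is
continuous at every point of `A`, all alive). [folklore] -/
theorem slidHull_subset_closure_range_slidPt {ω : Ω} (hW : Continuous (W ω)) (hA : IsStarHull A)
    (hdense : A ⊆ closure (range a)) (halive : Disjoint (closedHull (W ω) t) A) :
    slidHull (W ω) A t ⊆ closure (range fun k ↦ slidPt W a t k ω) := by
  rintro _ ⟨z, hz, rfl⟩
  have hcont : ContinuousAt (fun w ↦ map (W ω) t w - W ω t) z :=
    (continuousAt_map hW (lt_swallowingTime_of_alive hA halive hz)).sub continuousAt_const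
  have := mem_closure_image hcont (hdense hz)
  rwa [← range_comp] at this

/-! ### The configurations as measurable maps into a countable set -/

/-- The finite configuration of selected squares along a path. [folklore] -/
def slidConfig (hc : ∀ ω, Continuous (W ω)) (hA : IsBounded A) (ha : ∀ k, a k ∈ A ∧ 0 < (a k).im)
    (t : ℝ≥0) (n : ℕ) (ω : Ω) : Finset (ℤ × ℤ) :=
  (finite_outerConfig (isBounded_range_slidPt (t := t) hc hA ha ω) n).toFinset

/-- The finite configuration as a set is `outerConfig` of the slid points. [folklore] -/
theorem coe_slidConfig (hc : ∀ ω, Continuous (W ω)) (hA : IsBounded A) (ha : ∀ k, a k ∈ A ∧ 0 < (a k).im)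
    (n : ℕ) (ω : Ω) : (slidConfig hc hA ha t n ω : Set (ℤ × ℤ)) = outerConfig (fun k ↦ slidPt W a t k ω) n :=
  Finite.coe_toFinset _

/-- **The configuration map is measurable** into the countable set of finite configurations with
its discrete σ-algebra (passed explicitly): its fibres are countable Boolean combinations of the
events `{ω | dist(b_k(ω), Q) < 1/2ⁿ}`. [folklore] -/
theorem measurable_slidConfig (hc : ∀ ω, Continuous (W ω)) (hA : IsBounded A) (ha : ∀ k, a k ∈ A ∧ 0 < (a k).im)
    (hmeas : ∀ s, s ≤ t → Measurable fun ω ↦ W ω s) (n : ℕ) :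
    Measurable[mΩ, (⊤ : MeasurableSpace (Finset (ℤ × ℤ)))] (slidConfig hc hA ha t n) := by
  have hE : ∀ p : ℤ × ℤ, MeasurableSet {ω | p ∈ outerConfig (fun k ↦ slidPt W a t k ω) n} := by
    intro p
    have : {ω | p ∈ outerConfig (fun k ↦ slidPt W a t k ω) n} =
        ⋃ k, {ω | infDist (slidPt W a t k ω) (dyadicSquare n p.1 p.2) < 1 / 2 ^ n} := by
      ext ω; simp [outerConfig]
    rw [this]
    exact MeasurableSet.iUnion fun k ↦ measurableSet_lt
      ((continuous_infDist_pt (s := dyadicSquare n p.1 p.2)).measurable.comp (measurable_slidPt hc hmeas (fun k ↦ (ha k).2) k)) measurable_const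
  refine @measurable_to_countable' _ _ ⊤ _ _ _ fun F ↦ ?_
  have : slidConfig hc hA ha t n ⁻¹' {F} =
      ⋂ p : ℤ × ℤ, {ω | p ∈ outerConfig (fun k ↦ slidPt W a t k ω) n ↔ p ∈ F} := by
    ext ω
    simp only [mem_preimage, mem_singleton_iff, mem_iInter, mem_setOf_eq]
    rw [← Finset.coe_inj, coe_slidConfig, Set.ext_iff]
    simp only [Finset.mem_coe]
  rw [this]
  refine MeasurableSet.iInter fun p ↦ ?_
  by_cases hp : p ∈ F
  · simp only [hp, iff_true]; exact hE p
  · simp only [hp, iff_false]; exact (hE p).compl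

/-! ### Measurability of the derivative on the alive event -/

/-- **`ω ↦ Φ'_{A_t - W_t}(0) · 𝟙{alive}` is measurable.**
[cite: LawlerSchrammWerner2003Restriction, §5 (Y_t = h_t'(W_t)^{5/8})] -/
theorem measurable_indicator_starDeriv_slidHull (hc : ∀ ω, Continuous (W ω)) (hW0 : ∀ ω, W ω 0 = 0)
    (hmeas : ∀ s, s ≤ t → Measurable fun ω ↦ W ω s) (hA : IsStarHull A) (hne : A.Nonempty) :
    Measurable fun ω ↦ Set.indicator {ω | Disjoint (closedHull (W ω) t) A}
      (fun ω ↦ starDeriv (slidHull (W ω) A t)) ω := by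
  classical
  obtain ⟨a, ha, hdense⟩ := exists_denseSeq hA hne
  have hAb : IsBounded A := hA.isBoundedHull.isCompact.isBounded
  have hEm := measurableSet_disjoint_closedHull hc hW0 hmeas hA hne
  -- the approximants
  set G : ℕ → Ω → ℝ := fun n ω ↦ starDeriv (outerHull n (slidConfig hc hAb ha t n ω : Set (ℤ × ℤ))) with hG
  have hGm : ∀ n, Measurable (G n) := fun n ↦
    (@measurable_from_top _ _ _ (f := fun F : Finset (ℤ × ℤ) ↦ starDeriv (outerHull n (F : Set (ℤ × ℤ))))).comp
      (measurable_slidConfig hc hAb ha hmeas n)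
  have hGm' : ∀ n, Measurable fun ω ↦ Set.indicator {ω | Disjoint (closedHull (W ω) t) A} (G n) ω := fun n ↦
    (hGm n).indicator hEm
  refine measurable_of_tendsto_metrizable hGm' (tendsto_pi_nhds.2 fun ω ↦ ?_)
  by_cases hω : Disjoint (closedHull (W ω) t) A
  · simp only [Set.indicator_of_mem (show ω ∈ {ω | Disjoint (closedHull (W ω) t) A} from hω)]
    have hB := isStarHull_slidHull_of_disjoint (hc ω) hA hω
    have hb : ∀ k, slidPt W a t k ω ∈ slidHull (W ω) A t := fun k ↦ slidPt_mem (fun k ↦ (ha k).1) k ω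
    have hd := slidHull_subset_closure_range_slidPt (hc ω) hA hdense hω
    have := tendsto_starDeriv_outerHull hB (hne.image _) hb hd
    simp only [hG, coe_slidConfig]
    exact this
  · simp only [Set.indicator_of_notMem (show ω ∉ {ω | Disjoint (closedHull (W ω) t) A} from hω)]
    exact tendsto_const_nhds

end Loewner

end Literature.Probability.RandomPlanarGeometry
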